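/-
COR-CM (cell pub-hodgecm2, stage 2 of the Hodge ladder) — count-neutral KERNEL COMBINATORICS «the octic product column G = Q₈ × B, D₄ × B: blocks of the model and their invariants»
(seat prover-pub-hodgecm2-b23-g45-0, binder prover b23, gen 45; own census lane OCTIC-PRODUCT, claim HOME/INBOX.md l.18829).  Bookkeeping definitions with bodies (`blockSetoid`, `Block`, `blk`, `potB`) + theorems — gen 44ʼs `Census/QuarticInversionBlocks.lean` over the motions `twH₄`, `twZ ζ` (central `y`), `twT`; the Boolean signature `sigAll` of gen 44 and its invariance lemmas are used BY NAME (the halves and classes move under the central `y` exactly as under gen 44ʼs `y`); `decide` only via those lemmas, no certificate, no named fact, no `sorry`.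
`Interfaces.lean` (C1), every E term, B01, `Transposition/*`, `PortJoin/*`, `D2Bridge/*` untouched.
HONEST FRAMING: `HC_CM` is NOT proved, here or anywhere in the tree; nothing here is a period, a count of record or a headline.
T5: n/a-class (hypothesis binders = the datum equations / the slot data only); checker: self, 2026-08-24.
-/
import Summits.HodgeConjecture.CorCM.Census.QuarticInversionBlocks
import Summits.HodgeConjecture.CorCM.Census.OcticProductEquivariance

/-!
# The octic product column: the blocks of the model and their invariants

COR-CM (cell `pub-hodgecm2`, stage 2 of the Hodge ladder), count-neutral KERNEL COMBINATORICS by the binder seat b23 (gen 45; lane OCTIC-PRODUCT, HOME/INBOX.md l.18829 — the port of gen 44ʼs quartic inversion lane `Census/QuarticInversion*` to the datum with `y` CENTRAL on `ι(H₀)`).  On top of the corresponding parts of gen 44ʼs lane `Census/QuarticInversion*` (label-level, BY NAME) and the preceding `Census/OcticProduct*` files.  Bookkeeping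
definitions with bodies (`blockSetoid`, `Block`, `blk`, `potB`, the class vector `cl`, the Boolean signatures `xor4`, `sigAll`, `sig`, `inv`) +
theorems; `decide` only on closed Boolean identities over eight or nine Boolean literals (the invariance of the signatures under the three
motions), no certificate, no named fact, no geometry, no `sorry`.  `Interfaces.lean` (C1), every E term, B01, `Transposition/*`, `PortJoin/*`
untouched.
HONEST FRAMING: `HC_CM` is NOT proved, here or anywhere in the tree; nothing here is a period, a count of record or a headline.

CONTENT (`|B|` odd, square class `ζ`).
* §1 **The blocks of the model**: the classes of labels under the motions `twH₄ g`, `twY ζ`, `twT` (reachability = chains of motions, an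
  equivalence since every motion is undone by a chain); the potential of a block.
* §2 **Block invariants**: the potential, and the Boolean signature `sig ζ Θ` = (parity of the halves, the `ζ = 0` constant invariant,
  and three class-weighted relative-half invariants `W, X, V`) — each preserved by every motion (`sig_twH₄`, `sig_twZ`, `sig_twT`), hence
  constant on blocks (`inv_eq_of_blk_eq`).  `Census/OcticProductResidualBlocks` uses them to exhibit ten (`ζ = 1`) resp. twelve (`ζ = 0`) residual blocks.  All [folklore].

## References
* [Pohlmann1968] H. Pohlmann, Algebraic cycles on abelian varieties of complex multiplication type, Ann. of Math. 88 (1968), Thm 1.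
-/

namespace Summit.HodgeConjecture.CorCM.Census.OcticProduct

open Finset
open Summit.HodgeConjecture.CorCM.Census.OddSliceFacesModel
open Summit.HodgeConjecture.CorCM.Census.OddSliceFacesSquares (clsTy clsTy_tw)
open Summit.HodgeConjecture.CorCM.Census.DicyclicTwist (clsTy_rev)
open Summit.HodgeConjecture.CorCM.Census.EvenSliceFacesDescent (clsTy_add_one)

open Summit.HodgeConjecture.CorCM.Census.QuarticInversion (Ty₄ bY cl coord half hv inv pot₄ pot₄_twH₄ pot₄_twT sig sigAll sigAll_Y sig_twH₄ sig_twT twH₄ twH₄_twH₄ twH₄_zero twT twT_twT twY xor4 σY)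

noncomputable section

variable (A : Type) [AddCommGroup A] [Fintype A] [DecidableEq A] (ζ : ZMod 2)

/-! ## §1 The blocks of the model -/

omit [Fintype A] [DecidableEq A] in
/-- Every motion is undone by a chain of motions. [folklore] -/
theorem step_rev {Θ Θ' : Ty₄ A}
    (h : (∃ g : ZMod 2 × A, Θ' = twH₄ A g Θ) ∨ Θ' = twZ A ζ Θ ∨ Θ' = twT A Θ) :
    Relation.ReflTransGen (fun Θ₁ Θ₂ : Ty₄ A => (∃ g : ZMod 2 × A, Θ₂ = twH₄ A g Θ₁) ∨ Θ₂ = twZ A ζ Θ₁ ∨ Θ₂ = twT A Θ₁) Θ' Θ := by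
  rcases h with ⟨g, rfl⟩ | rfl | rfl
  · exact Relation.ReflTransGen.single (Or.inl ⟨-g, by rw [twH₄_twH₄, add_neg_cancel, twH₄_zero]⟩)
  · refine Relation.ReflTransGen.tail (Relation.ReflTransGen.single (Or.inr (Or.inl rfl))) (Or.inl ⟨-(ζ, 0), ?_⟩)
    rw [twZ_twZ, twH₄_twH₄, add_neg_cancel, twH₄_zero]
  · refine Relation.ReflTransGen.tail (Relation.ReflTransGen.single (Or.inr (Or.inr rfl))) (Or.inl ⟨-(1, 0), ?_⟩)
    rw [twT_twT, twH₄_twH₄, add_neg_cancel, twH₄_zero]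

/-- **The block relation**: reachability by a chain of motions (an equivalence). [folklore] -/
def blockSetoid : Setoid (Ty₄ A) where
  r := Relation.ReflTransGen (fun Θ₁ Θ₂ : Ty₄ A => (∃ g : ZMod 2 × A, Θ₂ = twH₄ A g Θ₁) ∨ Θ₂ = twZ A ζ Θ₁ ∨ Θ₂ = twT A Θ₁)
  iseqv := by
    refine ⟨fun _ => Relation.ReflTransGen.refl, fun h => ?_, fun h₁ h₂ => h₁.trans h₂⟩
    induction h with
    | refl => exact Relation.ReflTransGen.refl
    | tail _ hs ih => exact (step_rev A ζ hs).trans ih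

/-- **The blocks**: the orbits of `G_ζ(B)` on the labels of the model. [folklore] -/
def Block : Type := Quotient (blockSetoid A ζ)

/-- The blocks form a finite type. [folklore] -/
noncomputable instance : Fintype (Block A ζ) := by
  classical exact Quotient.fintype (blockSetoid A ζ)

/-- Equality of blocks is decidable (classically). [folklore] -/
noncomputable instance : DecidableEq (Block A ζ) := Classical.decEq _

/-- The block of a label. [folklore] -/
def blk (Θ : Ty₄ A) : Block A ζ := Quotient.mk (blockSetoid A ζ) Θ

omit [Fintype A] [DecidableEq A] in
/-- Two labels have the same block iff a chain of motions joins them. [folklore] -/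
theorem blk_eq_blk_iff (Θ Θ' : Ty₄ A) : blk A ζ Θ = blk A ζ Θ' ↔
    Relation.ReflTransGen (fun Θ₁ Θ₂ : Ty₄ A => (∃ g : ZMod 2 × A, Θ₂ = twH₄ A g Θ₁) ∨ Θ₂ = twZ A ζ Θ₁ ∨ Θ₂ = twT A Θ₁) Θ Θ' :=
  Quotient.eq (r := blockSetoid A ζ)

omit [Fintype A] [DecidableEq A] in
/-- Motions do not change the block. [folklore] -/
theorem blk_twH₄ (g : ZMod 2 × A) (Θ : Ty₄ A) : blk A ζ (twH₄ A g Θ) = blk A ζ Θ :=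
  ((blk_eq_blk_iff A ζ _ _).mpr (Relation.ReflTransGen.single (Or.inl ⟨g, rfl⟩))).symm

omit [Fintype A] [DecidableEq A] in
/-- The central `y` does not change the block. [folklore] -/
theorem blk_twZ (Θ : Ty₄ A) : blk A ζ (twZ A ζ Θ) = blk A ζ Θ :=
  ((blk_eq_blk_iff A ζ _ _).mpr (Relation.ReflTransGen.single (Or.inr (Or.inl rfl)))).symm

omit [Fintype A] [DecidableEq A] in
/-- `t` does not change the block. [folklore] -/
theorem blk_twT (Θ : Ty₄ A) : blk A ζ (twT A Θ) = blk A ζ Θ :=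
  ((blk_eq_blk_iff A ζ _ _).mpr (Relation.ReflTransGen.single (Or.inr (Or.inr rfl)))).symm

omit [DecidableEq A] in
/-- **The potential is a block invariant.** [folklore] -/
theorem pot₄_eq_of_reach {Θ Θ' : Ty₄ A}
    (h : Relation.ReflTransGen (fun Θ₁ Θ₂ : Ty₄ A => (∃ g : ZMod 2 × A, Θ₂ = twH₄ A g Θ₁) ∨ Θ₂ = twZ A ζ Θ₁ ∨ Θ₂ = twT A Θ₁) Θ Θ') :
    pot₄ A Θ = pot₄ A Θ' := by
  induction h with
  | refl => rfl
  | tail _ hs ih =>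
    rw [ih]
    rcases hs with ⟨g, rfl⟩ | rfl | rfl
    · exact (pot₄_twH₄ A g _).symm
    · exact (pot₄_twZ A ζ _).symm
    · exact (pot₄_twT A _).symm

/-- The potential of a block. [folklore] -/
def potB (B : Block A ζ) : ℕ := Quotient.liftOn B (pot₄ A) fun _ _ h => pot₄_eq_of_reach A ζ h

omit [DecidableEq A] in
/-- `potB (blk Θ) = pot₄ Θ`. [folklore] -/
@[simp] theorem potB_blk (Θ : Ty₄ A) : potB A ζ (blk A ζ Θ) = pot₄ A Θ := rfl

/-! ## §2 Invariance of gen 44ʼs Boolean signature under the central `y` -/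

omit [AddCommGroup A] [DecidableEq A] in
/-- Halves under the central `y` (the same bookkeeping as gen 44ʼs `y`). [folklore] -/
theorem hv_twZ (hA : Odd (Fintype.card A)) (Θ : Ty₄ A) : hv A (twZ A ζ Θ) = fun n => xor (hv A Θ (σY n)) (bY ζ n) :=
  funext fun n => half_coord_twZ A hA ζ Θ n

omit [DecidableEq A] in
/-- Classes of the coordinates under the central `y`. [folklore] -/
theorem clsTy_coord_twZ (Θ : Ty₄ A) (n : Fin 4) : clsTy A (coord A n (twZ A ζ Θ)) = clsTy A (coord A (σY n) Θ) := by
  rw [coord_twZ]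
  cases bY ζ n
  · rw [show (if false = true then (1 : Ty A) else 0) = 0 from rfl, add_zero]
  · rw [show (if true = true then (1 : Ty A) else 0) = 1 from rfl, clsTy_add_one]

omit [DecidableEq A] in
/-- Classes under the central `y`. [folklore] -/
theorem cl_twZ (Θ : Ty₄ A) : cl A (twZ A ζ Θ) = fun n => cl A Θ (σY n) := by
  funext n; unfold cl; rw [clsTy_coord_twZ]

omit [DecidableEq A] in
/-- **The signature is preserved by the central `y`** (gen 44ʼs `sigAll_Y`). [folklore] -/
theorem sig_twZ (hA : Odd (Fintype.card A)) (Θ : Ty₄ A) : sig A ζ (twZ A ζ Θ) = sig A ζ Θ := by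
  unfold sig; rw [hv_twZ A ζ hA, cl_twZ, sigAll_Y]

omit [DecidableEq A] in
/-- **The invariant vector is constant along chains of motions.** [folklore] -/
theorem inv_eq_of_reach (hA : Odd (Fintype.card A)) {Θ Θ' : Ty₄ A}
    (h : Relation.ReflTransGen (fun Θ₁ Θ₂ : Ty₄ A => (∃ g : ZMod 2 × A, Θ₂ = twH₄ A g Θ₁) ∨ Θ₂ = twZ A ζ Θ₁ ∨ Θ₂ = twT A Θ₁) Θ Θ') :
    inv A ζ Θ = inv A ζ Θ' := by
  induction h with
  | refl => rfl
  | tail _ hs ih =>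
    rw [ih]
    rcases hs with ⟨g, rfl⟩ | rfl | rfl
    · unfold inv; rw [pot₄_twH₄, sig_twH₄ A ζ hA]
    · unfold inv; rw [pot₄_twZ, sig_twZ A ζ hA]
    · unfold inv; rw [pot₄_twT, sig_twT A ζ hA]

omit [DecidableEq A] in
/-- **Labels in the same block have the same invariant vector.** [folklore] -/
theorem inv_eq_of_blk_eq (hA : Odd (Fintype.card A)) {Θ Θ' : Ty₄ A} (h : blk A ζ Θ = blk A ζ Θ') : inv A ζ Θ = inv A ζ Θ' :=
  inv_eq_of_reach A ζ hA ((blk_eq_blk_iff A ζ Θ Θ').mp h)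

end

end Summit.HodgeConjecture.CorCM.Census.OcticProduct
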